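import Summits.CriticalPhenomena.PercolationContinuityZ3.Theorems.Transplant.BoxProdZ2ConcFaceRun
import Summits.CriticalPhenomena.PercolationContinuityZ3.Theorems.Transplant.BoxProdZ2ConcParamsAtQ
import Summits.CriticalPhenomena.PercolationContinuityZ3.Theorems.Transplant.BoxProdZ2ConcClosureRun
import HarnessLib

/-!
# (F) AT THE CONCRETE CHOICES: `faceHoldsFn_concChoice₀ : FaceHoldsFn concChoice₀` and `faceHoldsRFn_concChoice₀ : FaceHoldsRFn concChoice₀`
# — the face obligations of design (D) for `X □ ℤ²` at stmt-g6's `concChoice₀` (BoxProdZ2ConcParams / ParamsAtQ), from `faceOblC_concGB'`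
# (routes discharged) with the inner constants `s₁ := s`, `nmax := 12 K`, `R'_A := R'`, `ℓ₀ := M + 1`, `ℓ1 := M + s + 2R' + 1`, `ℓ₁A := 6t`,
# `L'_A := ψ(6t) + ψ M`, `L_A := LAc`, inner excess entrances within `ψ(6t)`, accuracy `δA = min_{n ≤ 1000K} δUP n (δ₂²)`

builds on p205010 (kernel theorem, internal audit signed; external expert review pending) — nothing in this file uses p205010.
Lane `prim-bschramm`, seat `prim-bschramm-p3` (residue (F); lead ruling 16:29:39Z (2)); helper file (`--supports stmt-CriticalPhenomena-4575 --as helper`).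

* `Conc.inner_arith` — the seven constant inequalities of `route_of_contact` at `cellsOf K₀ R'` (`K ≥ 20`, `s = 400(R'+1)`, `r = K s`, `t = 100 K (R'+1)`);
* **`faceHoldsFn_concChoice₀`**, **`faceHoldsRFn_concChoice₀`**.
[cite: KozmaNitzan2024, §4 Theorem 6 (pp. 25–31), p. 30 (Step III), Lemma 11 (pp. 22–23)]
-/

noncomputable section

open MeasureTheory
open scoped Classical

namespace Summit.CriticalPhenomena.PercolationContinuityZ3.Theorems

namespace Transplant

namespace BoxProdZ2

open Literature.Probability.Percolation Literature.Probability.LatticeModels SimpleGraph KNCells KNLevels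
open Literature.Probability.Percolation.GM (HOct piece)
open Literature.Barriers.CriticalPhenomena (IsQuasiTransitive IsGraphAmenable)

namespace Conc

/-! ## §1 The inner-route arithmetic at the concrete cells -/

/-- **The constant inequalities of the inner routes at `C := cellsOf K₀ R'`** with `M + L + 1 = R'`, `s₁ := s = 400 (R'+1)`, `nmax := 12 K`,
`R'_A := R'`, `ℓ₀ := M + 1`, `ℓ1 := M + s + 2 R' + 1`, `ℓ₁A := 6 t`: `R' + ℓ₀ ≤ s₁`, `2 R' ≤ s₁`, `ℓ1 ≤ 6 t`, `s₁ + R' ≤ 6 t`,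
`12 r ≤ nmax · s₁`, `Rlev + ℓ1 + 2 s₁ + (nmax + 3) R' ≤ r`, `Rlev + ℓ1 + 1 ≤ 10 s` (`Rlev = M + L`). [this work] -/
theorem inner_arith (K₀ M L : ℕ) :
    let R' := M + L + 1
    let C := cellsOf K₀ R'
    let ℓ1 := M + C.s + 2 * R' + 1
    R' + (M + 1) ≤ C.s ∧ 2 * R' ≤ C.s ∧ ℓ1 ≤ 6 * tOf K₀ R' ∧ C.s + R' ≤ 6 * tOf K₀ R' ∧ 12 * C.r ≤ (12 * C.K) * C.s ∧
      (M + L) + ℓ1 + 2 * C.s + (12 * C.K + 3) * R' ≤ C.r ∧ (M + L) + ℓ1 + 1 ≤ 10 * C.s := by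
  intro R' C ℓ1
  have hK : 20 ≤ C.K := twenty_le_Kof K₀
  have hs : C.s = 400 * (R' + 1) := rfl
  have hr : C.r = C.K * C.s := rfl
  have ht : tOf K₀ R' = C.K * (100 * (R' + 1)) := rfl
  have hR' : R' = M + L + 1 := rfl
  have hℓ1 : ℓ1 = M + C.s + 2 * R' + 1 := rfl
  refine ⟨by omega, by omega, ?_, ?_, ?_, ?_, by omega⟩
  · rw [hℓ1, ht, hs]; nlinarith
  · rw [ht, hs]; nlinarith
  · rw [hr]; exact le_of_eq (by ring)
  · rw [hℓ1, hr, hs]; nlinarith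

end Conc

/-! ## §2 The face obligations at the concrete choices -/

/-- **`FaceHoldsFn concChoice₀`** (chosen-edge form): at every `(κ, X, w, p, hT)` and every `AtQ msel M₀ q`, the face obligations `FaceOblC`
of the concrete scheme hold — `faceOblC_concGB'` with the toolkit's unpacking lemmas and the inner constants of the header.
[cite: KozmaNitzan2024, §4 Theorem 6 (pp. 25–31), p. 30 (Step III)] -/
theorem faceHoldsFn_concChoice₀ : FaceHoldsFn concChoice₀ := by
  intro κ W _ _ X _ hΔ hc hqt ha hinf w p hp0 hp1 hT msel M₀ q hat
  rw [concChoice₀_eq] at hat ⊢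
  have hdA := δA_pos X κ hΔ
  set dA := δA X κ hΔ with hdAdef
  obtain ⟨a1, a2, a3, a4, a5, a6, a7⟩ := Conc.inner_arith κ.K₀ M₀ (Conc.Lc κ X hqt p hT dA M₀)
  have hq1 : (q : ℝ) < 1 := lt_of_le_of_lt (Conc.le_at hat) hp1
  have hLc := Conc.Lc_pos (κ := κ) (X := X) (hqt := hqt) (hT := hT) (M := M₀) hdA hp0 hp1
  have hrim := Conc.inner_rim_le (κ := κ) (X := X) (hqt := hqt) (w := w) (p := p) (hT := hT) (δA := dA) (M := M₀) (q := q)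
  have hηA : Conc.ηc κ dA ≤ dA / 2 := by
    unfold Conc.ηc; linarith [δmin_le_δA κ Conc.nR dA]
  have hη : Conc.ηc κ dA ≤ κ.δ / 2 := by
    unfold Conc.ηc; linarith [δmin_le_δ κ Conc.nR dA]
  rw [Conc.scheme_eq, Conc.faces_eq]
  exact faceOblC_concGB' X (Conc.Cc κ X hqt p hT dA M₀) w (Conc.gapc κ X hqt w p hT dA M₀ q) (fun _ => 0) (Conc.E₀c κ X hqt w p hT dA M₀ q)
    (Conc.L'c κ X hqt w p hT dA M₀ q) hΔ hT (reps X hqt) (frame_reps X hqt) κ.hδ₂0 (Conc.hmsel_at hat)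
    (Conc.hstd_at hat (δmin_le_δ₂ κ Conc.nR dA)) (L_A := Conc.LAc κ X hqt w p hT dA M₀ q) (Rlev := M₀ + Conc.Lc κ X hqt p hT dA M₀)
    Conc.ψ_le_E₀ Conc.hL_face (by omega) Conc.hRlev Conc.hRlev' (Conc.hN_at hdA hp0 hp1) (Conc.hk_at hat hp0 hp1 (δmin_le_δ₂ κ Conc.nR dA))
    (Conc.hcount_Icc_at hat hp0 hp1 (δmin_le_δ₂ κ Conc.nR dA)) hη (fun ρ => Conc.Rexc κ X hqt w p hT dA M₀ q (ρ + 1))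
    (Conc.hR₁_at hat le_rfl) Conc.hgap_face hdA (δA_le_one X κ hΔ) (Conc.hstd_at hat (δmin_le_δA κ Conc.nR dA)) (ℓ₀ := M₀ + 1)
    (ℓ₁A := 6 * Conc.tc κ X hqt p hT dA M₀) (Nat.lt_succ_self M₀) (Conc.hlink_at hat (δmin_le_δA κ Conc.nR dA)) (nmax := 12 * (Conc.Cc κ X hqt p hT dA M₀).K)
    (fun n hn π => chain_of_le X (δA_le_δUP X κ hΔ (by change n ≤ 1000 * Kof κ.K₀; change n ≤ 12 * Kof κ.K₀ at hn; omega))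
      (δUP_spec X hΔ n (pow_pos κ.hδ₂0 2) q hq1 π))
    (L'A := Conc.ψ X hqt p hT (6 * Conc.tc κ X hqt p hT dA M₀) + Conc.ψ X hqt p hT M₀) (s₁ := (Conc.Cc κ X hqt p hT dA M₀).s)
    (R'A := Conc.R'c κ X hqt p hT dA M₀) (RlevA := M₀ + Conc.Lc κ X hqt p hT dA M₀) (kkA := Conc.kc κ X hqt p hT dA M₀)
    (N_A := Conc.Nc κ X hqt p hT dA M₀) (ℓ1 := M₀ + (Conc.Cc κ X hqt p hT dA M₀).s + 2 * Conc.R'c κ X hqt p hT dA M₀ + 1)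
    le_rfl (by unfold Conc.LAc; omega) Conc.hRl a1 a2 le_rfl a3 a4 a5 a6 a7 (Conc.hN_at hdA hp0 hp1)
    (Conc.hk_at hat hp0 hp1 (δmin_le_δA κ Conc.nR dA)) (Conc.hcount_Icc_at hat hp0 hp1 (δmin_le_δA κ Conc.nR dA)) hηA
    (R₀A := Conc.ψ X hqt p hT (6 * Conc.tc κ X hqt p hT dA M₀)) (R₁A := Conc.Rexc κ X hqt w p hT dA M₀ q (Conc.ψ X hqt p hT (6 * Conc.tc κ X hqt p hT dA M₀)))
    Conc.ψ_le_ψ_top (Conc.hRexV_at hat le_rfl _) (by omega)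

/-- **`FaceHoldsRFn concChoice₀`** (run form, consumed by `thetaDropBoxProdZ2_of_choiceFnR`). [cite: KozmaNitzan2024, §4 Theorem 6 (pp. 25–31)] -/
theorem faceHoldsRFn_concChoice₀ : FaceHoldsRFn concChoice₀ :=
  faceHoldsRFn_of_faceHoldsFn faceHoldsFn_concChoice₀

end BoxProdZ2

end Transplant

end Summit.CriticalPhenomena.PercolationContinuityZ3.Theorems

end
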